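import Mathlib
import Summits.NavierStokesRegularity.NavierStokesRegularity.Theorems.EulerZoomLiouvillePowerGaugeEulerLiouvilleSelfSimilarTopBadNodeLandscapeIntegral
import Summits.NavierStokesRegularity.NavierStokesRegularity.Theorems.EulerZoomLiouvillePowerGaugeEulerLiouvilleSelfSimilarTopBadNodeTubeDynamics
import HarnessLib.Audit

/-!
# Rung C1 of the crux `EulerZoomLiouville.PowerGaugeEulerLiouville`: tools for the exit cases of the no-exit lemma
# (blueprint §2 — pieces shared by CASE (T) and CASE (NT-bump))

Route №10 `EulerZoomLiouville` (NavierStokesRegularity), crux E = stmt-NavierStokesRegularity-19832,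
tenure rung C1 (exactly self-similar members), registered residue `stub_selfSimilarExtremal`.
Twenty-fourth file of the NODAL-CONTINUUM line (lineage ns-typeII-p1, gen 7).  `V = γ(y−c)+U`, `ℋ` (3.30), `z` a node with
`curl U(z) = 0`, `A = DV(z)`, unit kernel vector `e`, kernel graph `τ ↦ z + τe + g(τ)` with `V = φe` on it.

* `norm_transport_ge_of_tube` — linear algebra: `|V(Y) − φe − Aξ| ≤ ρ|ξ|` (`ξ ⊥ e`, `|Aξ| ≥ μ|ξ|`, `ρ ≤ μ/2`) gives
  `|V(Y)| ≥ (μ/2)|ξ|` and `(⟪e, V(Y)⟫ − φ)² ≤ (4ρ²/μ²)|V(Y)|²`.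
* `abs_fderiv_selfSimilarBernoulli_le` — at a graph point `y` (`V(y) = φ₀e`), for `w ⊥ e`:
  `|Dℋ(y)w| ≤ |φ₀|·2‖DU(y) − DU(z)‖·|w|` (`DU(z)` is symmetric).
* `landscape_offset_le` — `|ℋ(z + σ₀e + g(σ₀)) − ℋ(z)| ≤ (3(1−2γ)/2)·(sup_{|τ|≤ε}|φ|)·|σ₀|` for `|σ₀| ≤ ε`.
* `landscape_deficit` — along a backward trajectory `Y` on `[0, t₁]` with `ℋ(Y t₁) < ℋ(z)`, `ℋ(Y 0) ≥ ℋ(z) − C₃ε²` and the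
  deviation bound `(⟪e,V(Y)⟫ − φ(σ))² ≤ (4ρ²/μ²)|V(Y)|²`:
  `ℋ(Γ(σ(t₁))) ≥ ℋ(Γ(σ(0))) − 3ρ²C₃ε²/μ² + ((1−2γ)/4)∫₀^{t₁} φ(σ)²` (`selfSimilarBernoulli_graph_gain` + the speed-square
  budget `bernoulli_comp_sub_eq`).

WHAT THIS IS NOT: not NS, not E — local bookkeeping lemmas.
[cite: ConstantinIgnatovaVicol2026Putative, §3.4.3–§3.5, §4 (local analysis not in print)]
-/

noncomputable section

-- flat `Theorems/<Route><Decl>…` files of one crux share the namespace of the crux (tree convention)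
set_option linter.dupNamespace false

open Set Filter Topology Metric Function InnerProductSpace MeasureTheory intervalIntegral
open scoped RealInnerProductSpace NNReal

namespace Summit.NavierStokesRegularity.NavierStokesRegularity.Theorems.PowerGaugeEulerLiouville.NodalContinuum

open Literature.Analysis Literature.Analysis.FluidPDE Literature.Analysis.ODE
open Summit.NavierStokesRegularity.NavierStokesRegularity.Theorems.PowerGaugeEulerLiouville.NodalFiniteness

variable {γ C : ℝ} {c : EuclideanSpace ℝ (Fin 3)}
  {U : EuclideanSpace ℝ (Fin 3) → EuclideanSpace ℝ (Fin 3)} {P : EuclideanSpace ℝ (Fin 3) → ℝ}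

/-- **Speed versus transversal coordinate.**  Linear algebra of the tube decomposition `V(Y) = φe + Aξ + E`,
`|E| ≤ ρ|ξ|`, `ξ ⊥ e = ker`-direction, `|Aξ| ≥ μ|ξ|`, `ρ ≤ μ/2`. [folklore] -/
theorem norm_transport_ge_of_tube {A : EuclideanSpace ℝ (Fin 3) →L[ℝ] EuclideanSpace ℝ (Fin 3)}
    (hA : (A : EuclideanSpace ℝ (Fin 3) →ₗ[ℝ] EuclideanSpace ℝ (Fin 3)).IsSymmetric)
    (b : OrthonormalBasis (Fin 3) ℝ (EuclideanSpace ℝ (Fin 3))) {a : Fin 3 → ℝ}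
    (hb : ∀ i, A (b i) = a i • b i) {μ : ℝ} (hμ : 0 < μ) (hpos : ∀ i, 0 < a i → μ ≤ a i)
    {e : EuclideanSpace ℝ (Fin 3)} (he1 : ‖e‖ = 1) (hAe : A e = 0)
    {ξ Vy : EuclideanSpace ℝ (Fin 3)} {φ₀ ρ : ℝ} (hneg : ∀ i, ¬ 0 < a i → a i ≤ -μ ∨ ⟪b i, ξ⟫ = 0)
    (hE : ‖Vy - φ₀ • e - A ξ‖ ≤ ρ * ‖ξ‖) (hρ2 : ρ ≤ μ / 2) :
    μ / 2 * ‖ξ‖ ≤ ‖Vy‖ ∧ (⟪e, Vy⟫ - φ₀) ^ 2 ≤ 4 * ρ ^ 2 / μ ^ 2 * ‖Vy‖ ^ 2 := by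
  have hee : ⟪e, e⟫ = 1 := by rw [real_inner_self_eq_norm_sq, he1]; norm_num
  have hsym : ⟪e, A ξ⟫ = 0 := by
    have := hA e ξ
    simp only [ContinuousLinearMap.coe_coe] at this
    rw [← this, hAe, inner_zero_left]
  have h2 : μ * ‖ξ‖ ≤ ‖A ξ‖ := norm_apply_ge_of_eigen hA b hb hμ hpos ξ hneg
  have horth : ⟪φ₀ • e, A ξ⟫ = 0 := by rw [real_inner_smul_left, hsym, mul_zero]
  have h3 : ‖A ξ‖ ≤ ‖φ₀ • e + A ξ‖ := by
    have e1 : ‖φ₀ • e + A ξ‖ ^ 2 = ‖φ₀ • e‖ ^ 2 + ‖A ξ‖ ^ 2 := by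
      have := norm_add_sq_real (φ₀ • e) (A ξ)
      rw [horth] at this; linarith
    have : ‖A ξ‖ ^ 2 ≤ ‖φ₀ • e + A ξ‖ ^ 2 := by rw [e1]; linarith [sq_nonneg ‖φ₀ • e‖]
    exact (pow_le_pow_iff_left₀ (norm_nonneg _) (norm_nonneg _) two_ne_zero).1 this
  have h4 : ‖φ₀ • e + A ξ‖ ≤ ‖Vy‖ + ρ * ‖ξ‖ := by
    have : φ₀ • e + A ξ = Vy - (Vy - φ₀ • e - A ξ) := by abel
    rw [this]
    exact (norm_sub_le _ _).trans (by linarith)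
  have h5 : ρ * ‖ξ‖ ≤ μ / 2 * ‖ξ‖ := mul_le_mul_of_nonneg_right hρ2 (norm_nonneg _)
  have hlow : μ / 2 * ‖ξ‖ ≤ ‖Vy‖ := by linarith
  refine ⟨hlow, ?_⟩
  have h6 : |⟪e, Vy⟫ - φ₀| ≤ ρ * ‖ξ‖ := by
    have e1 : ⟪e, Vy⟫ - φ₀ = ⟪e, Vy - φ₀ • e - A ξ⟫ := by
      rw [inner_sub_right, inner_sub_right, inner_smul_right, hee, hsym]; ring
    rw [e1]
    exact ((abs_real_inner_le_norm _ _).trans (by rw [he1, one_mul])).trans hE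
  have h7 : (⟪e, Vy⟫ - φ₀) ^ 2 ≤ (ρ * ‖ξ‖) ^ 2 := by
    rw [← sq_abs]; exact pow_le_pow_left₀ (abs_nonneg _) h6 2
  have h8 : (μ / 2 * ‖ξ‖) ^ 2 ≤ ‖Vy‖ ^ 2 := pow_le_pow_left₀ (by positivity) hlow 2
  have e2 : (ρ * ‖ξ‖) ^ 2 = 4 * ρ ^ 2 / μ ^ 2 * (μ / 2 * ‖ξ‖) ^ 2 := by field_simp; ring
  rw [e2] at h7
  exact h7.trans (mul_le_mul_of_nonneg_left h8 (by positivity))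

/-- **The linear term of the off-node expansion at a graph point.**  If `V(y) = φ₀e` and `w ⊥ e`, then
`|Dℋ(y)w| ≤ |φ₀|·(2‖DU(y) − DU(z)‖)·|w|` (`Dℋ(y)w = φ₀(⟪e, DU(y)w⟫ − ⟪DU(y)e, w⟫)` by
`fderiv_selfSimilarBernoulli_of_transport_parallel`, and `DU(z)` is symmetric at a non-vortical `z`).
[cite: ConstantinIgnatovaVicol2026Putative, §3.4.3 (3.30)] -/
theorem abs_fderiv_selfSimilarBernoulli_le (h : IsSelfSimilarEulerProfile γ c U P)
    {z y e w : EuclideanSpace ℝ (Fin 3)} (hΩz : curl U z = 0) (he1 : ‖e‖ = 1) {φ₀ : ℝ}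
    (hV : selfSimilarTransport γ c U y = φ₀ • e) (hw : ⟪e, w⟫ = 0) :
    |fderiv ℝ (selfSimilarBernoulli γ c U P) y w| ≤
      |φ₀| * (2 * ‖fderiv ℝ U y - fderiv ℝ U z‖) * ‖w‖ := by
  have e1 := fderiv_selfSimilarBernoulli_of_transport_parallel h hV w
  rw [e1, hw, mul_zero, zero_add, abs_mul, mul_assoc]
  apply mul_le_mul_of_nonneg_left _ (abs_nonneg _)
  have hS := isSymmetric_fderiv_of_curl_eq_zero (h.differentiable_velocity z) hΩz
  set D : EuclideanSpace ℝ (Fin 3) →L[ℝ] EuclideanSpace ℝ (Fin 3) := fderiv ℝ U y - fderiv ℝ U z with hDdef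
  have hD : ∀ v, fderiv ℝ U y v = fderiv ℝ U z v + D v := fun v => by
    rw [hDdef, sub_apply]; abel
  have hsymz : ⟪e, fderiv ℝ U z w⟫ = ⟪fderiv ℝ U z e, w⟫ := by
    have := hS e w
    simp only [ContinuousLinearMap.coe_coe] at this
    exact this.symm
  have e2 : ⟪e, fderiv ℝ U y w⟫ - ⟪fderiv ℝ U y e, w⟫ = ⟪e, D w⟫ - ⟪D e, w⟫ := by
    rw [hD w, hD e, inner_add_right, inner_add_left, hsymz]; ring
  rw [e2]
  have h1 : |⟪e, D w⟫| ≤ ‖D‖ * ‖w‖ := by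
    calc |⟪e, D w⟫| ≤ ‖e‖ * ‖D w‖ := abs_real_inner_le_norm _ _
      _ ≤ 1 * (‖D‖ * ‖w‖) := by rw [he1]; exact mul_le_mul_of_nonneg_left (D.le_opNorm w) zero_le_one
      _ = ‖D‖ * ‖w‖ := one_mul _
  have h2 : |⟪D e, w⟫| ≤ ‖D‖ * ‖w‖ := by
    calc |⟪D e, w⟫| ≤ ‖D e‖ * ‖w‖ := abs_real_inner_le_norm _ _
      _ ≤ (‖D‖ * ‖e‖) * ‖w‖ := mul_le_mul_of_nonneg_right (D.le_opNorm e) (norm_nonneg _)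
      _ = ‖D‖ * ‖w‖ := by rw [he1, mul_one]
  calc |⟪e, D w⟫ - ⟪D e, w⟫| ≤ |⟪e, D w⟫| + |⟪D e, w⟫| := abs_sub _ _
    _ ≤ 2 * ‖D‖ * ‖w‖ := by linarith

/-- **Initial offset of the landscape.**  With `G(τ) = ℋ(z + τe + g(τ))`, `G' = φ((2γ−1) + θ)`, `|θ| ≤ (1−2γ)/2`
(`hasDerivAt_selfSimilarBernoulli_graph` + `hθ`), and `|φ| ≤ Cφ` on `|τ| ≤ ε`:
`|G(σ₀) − ℋ(z)| ≤ (3(1−2γ)/2)·Cφ·|σ₀|` for `|σ₀| ≤ ε ≤ r`. [cite: ConstantinIgnatovaVicol2026Putative, §3.4.3 (3.30)] -/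
theorem landscape_offset_le (h : IsSelfSimilarEulerProfile γ c U P) (hγ2 : γ < 1 / 2)
    {z e : EuclideanSpace ℝ (Fin 3)} (hΩz : curl U z = 0) (he1 : ‖e‖ = 1)
    {g g' : ℝ → EuclideanSpace ℝ (Fin 3)} {φ : ℝ → ℝ} (hg0 : g 0 = 0) (hge : ∀ τ, ⟪e, g τ⟫ = 0)
    (hgd : ∀ τ, HasDerivAt g (g' τ) τ) {r ε Cφ σ₀ : ℝ} (hεr : ε ≤ r) (hCφ : 0 ≤ Cφ)
    (hpar : ∀ τ, |τ| ≤ r → selfSimilarTransport γ c U (z + τ • e + g τ) = φ τ • e)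
    (hθ : ∀ τ, |τ| ≤ r → 2 * ‖fderiv ℝ U (z + τ • e + g τ) - fderiv ℝ U z‖ * ‖e + g' τ‖ ≤ (1 - 2 * γ) / 2)
    (hφb : ∀ τ, |τ| ≤ ε → |φ τ| ≤ Cφ) (hσ₀ : |σ₀| ≤ ε) :
    |selfSimilarBernoulli γ c U P (z + σ₀ • e + g σ₀) - selfSimilarBernoulli γ c U P z| ≤
      3 * (1 - 2 * γ) / 2 * Cφ * |σ₀| := by
  set Hb := selfSimilarBernoulli γ c U P with hHb
  set G : ℝ → ℝ := fun τ => Hb (z + τ • e + g τ) with hGdef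
  have h12 : 0 < 1 - 2 * γ := by linarith
  have hGd : ∀ τ, |τ| ≤ ε → HasDerivAt G (deriv G τ) τ ∧ ‖deriv G τ‖ ≤ 3 * (1 - 2 * γ) / 2 * Cφ := by
    intro τ hτ
    have hτr : |τ| ≤ r := hτ.trans hεr
    obtain ⟨θ, hθb, hder⟩ := hasDerivAt_selfSimilarBernoulli_graph h hΩz he1 hge (hgd τ) (hpar τ hτr)
    rw [← hHb] at hder
    have hθ' : |θ| ≤ (1 - 2 * γ) / 2 := hθb.trans (hθ τ hτr)
    refine ⟨hder.differentiableAt.hasDerivAt, ?_⟩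
    rw [hder.deriv, Real.norm_eq_abs, abs_mul]
    have h2 : |2 * γ - 1 + θ| ≤ 3 * (1 - 2 * γ) / 2 := by
      rw [abs_le] at hθ' ⊢; constructor <;> linarith [hθ'.1, hθ'.2]
    calc |φ τ| * |2 * γ - 1 + θ| ≤ Cφ * (3 * (1 - 2 * γ) / 2) :=
          mul_le_mul (hφb τ hτ) h2 (abs_nonneg _) hCφ
      _ = 3 * (1 - 2 * γ) / 2 * Cφ := by ring
  have hmv := (convex_Icc (-|σ₀|) |σ₀|).norm_image_sub_le_of_norm_hasDerivWithin_le
    (f := G) (f' := deriv G) (C := 3 * (1 - 2 * γ) / 2 * Cφ)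
    (fun x hx => (hGd x ((abs_le.2 ⟨hx.1, hx.2⟩).trans hσ₀)).1.hasDerivWithinAt)
    (fun x hx => (hGd x ((abs_le.2 ⟨hx.1, hx.2⟩).trans hσ₀)).2)
    (show (0 : ℝ) ∈ Icc (-|σ₀|) |σ₀| from ⟨by simp, by simp⟩)
    (show σ₀ ∈ Icc (-|σ₀|) |σ₀| from ⟨neg_abs_le _, le_abs_self _⟩)
  rw [sub_zero, Real.norm_eq_abs, Real.norm_eq_abs] at hmv
  have hG0 : G 0 = Hb z := by simp [hGdef, hg0]
  rw [hG0] at hmv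
  exact hmv

/-- **Landscape deficit along a trajectory.**  See the module docstring.
[cite: ConstantinIgnatovaVicol2026Putative, §3.4.3 (3.30)–(3.31)] -/
theorem landscape_deficit (h : IsSelfSimilarEulerProfile γ c U P) (hγ2 : γ < 1 / 2)
    {z e : EuclideanSpace ℝ (Fin 3)} (hΩz : curl U z = 0) (he1 : ‖e‖ = 1)
    {g g' : ℝ → EuclideanSpace ℝ (Fin 3)} (hge : ∀ τ, ⟪e, g τ⟫ = 0) (hgd : ∀ τ, HasDerivAt g (g' τ) τ)
    {φ : ℝ → ℝ} (hφc : Continuous φ) {r : ℝ}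
    (hpar : ∀ τ, |τ| ≤ r → selfSimilarTransport γ c U (z + τ • e + g τ) = φ τ • e)
    (hθ : ∀ τ, |τ| ≤ r → 2 * ‖fderiv ℝ U (z + τ • e + g τ) - fderiv ℝ U z‖ * ‖e + g' τ‖ ≤ (1 - 2 * γ) / 2)
    {Y : ℝ → EuclideanSpace ℝ (Fin 3)}
    (hY : ∀ t, HasDerivAt Y ((-1 : ℝ) • selfSimilarTransport γ c U (Y t)) t) {t₁ : ℝ} (ht₁ : 0 ≤ t₁)
    (hσr : ∀ t ∈ Icc 0 t₁, |⟪e, Y t - z⟫| ≤ r) {ρ μ C₃ ε : ℝ} (hμ : 0 < μ)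
    (hdev : ∀ t ∈ Icc 0 t₁, (⟪e, selfSimilarTransport γ c U (Y t)⟫ - φ ⟪e, Y t - z⟫) ^ 2 ≤
      4 * ρ ^ 2 / μ ^ 2 * ‖selfSimilarTransport γ c U (Y t)‖ ^ 2)
    (hHlt : selfSimilarBernoulli γ c U P (Y t₁) < selfSimilarBernoulli γ c U P z)
    (hH0 : selfSimilarBernoulli γ c U P z - C₃ * ε ^ 2 ≤ selfSimilarBernoulli γ c U P (Y 0)) :
    selfSimilarBernoulli γ c U P (z + ⟪e, Y 0 - z⟫ • e + g ⟪e, Y 0 - z⟫) - 3 * ρ ^ 2 * C₃ * ε ^ 2 / μ ^ 2 +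
        (1 - 2 * γ) / 4 * (∫ t in (0:ℝ)..t₁, φ ⟪e, Y t - z⟫ ^ 2) ≤
      selfSimilarBernoulli γ c U P (z + ⟪e, Y t₁ - z⟫ • e + g ⟪e, Y t₁ - z⟫) := by
  set V := selfSimilarTransport γ c U with hV
  set Hb := selfSimilarBernoulli γ c U P with hHb
  have h12 : 0 < 1 - 2 * γ := by linarith
  have hgain := selfSimilarBernoulli_graph_gain h hγ2 hΩz he1 hge hgd hφc hpar hθ hY ht₁ hσr
  rw [← hV, ← hHb] at hgain
  -- continuity
  have hYc : Continuous Y := continuous_iff_continuousAt.2 fun t => (hY t).continuousAt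
  have hVc : Continuous V := by
    have e1 : V = fun y => γ • (y - c) + U y := rfl
    rw [e1]
    exact ((continuous_id.sub continuous_const).const_smul γ).add h.contDiff_velocity.continuous
  have hσc : Continuous fun t => ⟪e, Y t - z⟫ := continuous_const.inner (hYc.sub continuous_const)
  have hφσc : Continuous fun t => φ ⟪e, Y t - z⟫ ^ 2 := (hφc.comp hσc).pow 2
  have hdevc : Continuous fun t => (⟪e, V (Y t)⟫ - φ ⟪e, Y t - z⟫) ^ 2 :=
    ((continuous_const.inner (hVc.comp hYc)).sub (hφc.comp hσc)).pow 2
  have hVYc : Continuous fun t => ‖V (Y t)‖ ^ 2 := ((hVc.comp hYc).norm).pow 2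
  -- split the gain integral
  have hi1 : IntervalIntegrable (fun t => (1 - 2 * γ) / 4 * φ ⟪e, Y t - z⟫ ^ 2) volume 0 t₁ :=
    (continuous_const.mul hφσc).intervalIntegrable 0 t₁
  have hi2 : IntervalIntegrable (fun t => 3 * (1 - 2 * γ) / 4 * (⟪e, V (Y t)⟫ - φ ⟪e, Y t - z⟫) ^ 2) volume 0 t₁ :=
    (continuous_const.mul hdevc).intervalIntegrable 0 t₁
  have hsplit : (∫ t in (0:ℝ)..t₁, ((1 - 2 * γ) / 4 * φ ⟪e, Y t - z⟫ ^ 2 -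
      3 * (1 - 2 * γ) / 4 * (⟪e, V (Y t)⟫ - φ ⟪e, Y t - z⟫) ^ 2)) =
      (1 - 2 * γ) / 4 * (∫ t in (0:ℝ)..t₁, φ ⟪e, Y t - z⟫ ^ 2) -
        3 * (1 - 2 * γ) / 4 * (∫ t in (0:ℝ)..t₁, (⟪e, V (Y t)⟫ - φ ⟪e, Y t - z⟫) ^ 2) := by
    rw [intervalIntegral.integral_sub hi1 hi2,
      intervalIntegral.integral_const_mul, intervalIntegral.integral_const_mul]
  rw [hsplit] at hgain
  -- the deviation integral against the speed-square budget
  have hi3 : IntervalIntegrable (fun t => (⟪e, V (Y t)⟫ - φ ⟪e, Y t - z⟫) ^ 2) volume 0 t₁ :=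
    hdevc.intervalIntegrable 0 t₁
  have hi4 : IntervalIntegrable (fun t => 4 * ρ ^ 2 / μ ^ 2 * ‖V (Y t)‖ ^ 2) volume 0 t₁ :=
    (continuous_const.mul hVYc).intervalIntegrable 0 t₁
  have hmono := intervalIntegral.integral_mono_on ht₁ hi3 hi4 hdev
  rw [intervalIntegral.integral_const_mul] at hmono
  have hspeed := h.bernoulli_comp_sub_eq hY 0 t₁
  rw [← hHb, ← hV] at hspeed
  have hbudget : ∫ t in (0:ℝ)..t₁, ‖V (Y t)‖ ^ 2 ≤ C₃ * ε ^ 2 / (1 - 2 * γ) := by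
    have e1 : Hb (Y t₁) - Hb (Y 0) = (1 - 2 * γ) * ∫ t in (0:ℝ)..t₁, ‖V (Y t)‖ ^ 2 := by
      rw [hspeed]; ring
    rw [le_div_iff₀ h12]
    nlinarith [hHlt, hH0, e1]
  have h1 : 3 * (1 - 2 * γ) / 4 * (∫ t in (0:ℝ)..t₁, (⟪e, V (Y t)⟫ - φ ⟪e, Y t - z⟫) ^ 2) ≤
      3 * ρ ^ 2 * C₃ * ε ^ 2 / μ ^ 2 := by
    have h2 : (∫ t in (0:ℝ)..t₁, (⟪e, V (Y t)⟫ - φ ⟪e, Y t - z⟫) ^ 2) ≤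
        4 * ρ ^ 2 / μ ^ 2 * (C₃ * ε ^ 2 / (1 - 2 * γ)) :=
      hmono.trans (mul_le_mul_of_nonneg_left hbudget (by positivity))
    have h3 := mul_le_mul_of_nonneg_left h2 (by positivity : (0:ℝ) ≤ 3 * (1 - 2 * γ) / 4)
    have e2 : 3 * (1 - 2 * γ) / 4 * (4 * ρ ^ 2 / μ ^ 2 * (C₃ * ε ^ 2 / (1 - 2 * γ))) =
        3 * ρ ^ 2 * C₃ * ε ^ 2 / μ ^ 2 := by
      field_simp
    linarith
  linarith

end Summit.NavierStokesRegularity.NavierStokesRegularity.Theorems.PowerGaugeEulerLiouville.NodalContinuum
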